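import Literature.Analysis.FluidPDE.PineauVicolRSSProofs
import Literature.Analysis.FluidPDE.EulerTimeScaling
import HarnessLib

/-!
# Crux `FrequencyRigidity` (stmt-NavierStokesRegularity-2955), line `scaled-energy-split`:
# the viscosity normalisation of a rotated self-similar flow

Helper file (`--supports stmt-NavierStokesRegularity-2955`; theorems only, sorry-free).  Stub
`stub_rssViscosityNormalisation`: pure bookkeeping.  Let `ν > 0` and let `v(t, x)` agree, for
`t < 0`, with Pineau–Vicol's rotated self-similar (RSS) ansatz field with angular speed `α` and
an `s`-independent profile `U`,
`v(t, x) = (−t)^{−1/2} R(αs) U(R(−αs) x/√(−t))`, `s = −log(−t)` (`pvAnsatz α (fun y _ => U y)`,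
Pineau–Vicol 2026 (1.7)), `R(θ) = rotZ θ` the rotation by `θ` about the `e₃`-axis.  Then the
viscosity normalisation `u(t, x) = ν⁻¹ v(ν⁻¹ t, x)` (which turns a viscosity-`ν` Navier–Stokes
flow into a unit-viscosity one) is, for `t < 0`, again an RSS ansatz field with the same angular
speed `α` and the explicit profile
`Ũ(y) = (√ν)⁻¹ R(α log ν) U(√ν R(−α log ν) y)`.

Proof.  With `s := ν⁻¹ t < 0` one has `√(−s) = (√ν)⁻¹ √(−t)` and
`−log(−s) = −log(−t) + log ν`, so the rotation angle at time `s` is `θ + c` with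
`θ = −α log(−t)`, `c = α log ν`; now `R(θ + c) = R(θ) R(c)`, `R(−(θ + c)) = R(−c) R(−θ)`
(`rotZ_add`), rotations commute with scalars (`rotZ_smul`), and `ν⁻¹ √ν = (√ν)⁻¹`.

## References

* B. Pineau, V. Vicol, *On rotated backwards self-similar solutions of the incompressible 3D
  Navier–Stokes equations*, arXiv:2607.09619 (2026), (1.7). [PineauVicol2026]
-/

noncomputable section

-- the registered stub namespace repeats the summit name `NavierStokesRegularity` (summit = problem)
set_option linter.dupNamespace false

namespace Summit.NavierStokesRegularity.NavierStokesRegularity.Theorems.FrequencyRigidity.ScaledEnergySplit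

open Literature.Analysis.FluidPDE Set

/-- Time dilation of the self-similar scale: for `ν > 0`,
`(√(−ν⁻¹ t))⁻¹ = √ν · (√(−t))⁻¹`. [folklore] -/
theorem rssVisc_inv_sqrt_neg_inv_mul {ν : ℝ} (hν : 0 < ν) (t : ℝ) :
    (Real.sqrt (-(ν⁻¹ * t)))⁻¹ = Real.sqrt ν * (Real.sqrt (-t))⁻¹ := by
  rw [show -(ν⁻¹ * t) = ν⁻¹ * -t by ring, Real.sqrt_mul (inv_nonneg.2 hν.le), Real.sqrt_inv,
    mul_inv_rev, inv_inv, mul_comm]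

/-- Time dilation of the self-similar clock: for `ν > 0` and `t < 0`,
`−α log(−ν⁻¹ t) = −α log(−t) + α log ν`. [folklore] -/
theorem rssVisc_angle_inv_mul {ν : ℝ} (hν : 0 < ν) (α : ℝ) {t : ℝ} (ht : t < 0) :
    α * -Real.log (-(ν⁻¹ * t)) = α * -Real.log (-t) + α * Real.log ν := by
  rw [show -(ν⁻¹ * t) = ν⁻¹ * -t by ring,
    Real.log_mul (inv_ne_zero hν.ne') (neg_ne_zero.2 ht.ne), Real.log_inv]
  ring

/-- The amplitude bookkeeping: `ν⁻¹ (√ν a) = a (√ν)⁻¹` (for `ν ≤ 0` both sides vanish by the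
junk value `√ν = 0`). [folklore] -/
theorem rssVisc_inv_mul_sqrt_mul (ν a : ℝ) :
    ν⁻¹ * (Real.sqrt ν * a) = a * (Real.sqrt ν)⁻¹ := by
  have h : ν⁻¹ * Real.sqrt ν = (Real.sqrt ν)⁻¹ := by
    rw [inv_mul_eq_div, Real.sqrt_div_self]
  rw [← mul_assoc, h, mul_comm]

/-- **Stub `stub_rssViscosityNormalisation`.**  The viscosity normalisation
`u(t, x) = ν⁻¹ v(ν⁻¹ t, x)` of a rotated self-similar ansatz field
`v = pvAnsatz α U` (`t < 0`, `s`-independent profile `U`) is the rotated self-similar ansatz field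
with the same angular speed `α` and the profile `Ũ(y) = (√ν)⁻¹ R(α log ν) U(√ν R(−α log ν) y)`.
[cite: PineauVicol2026, (1.7) (arXiv:2607.09619 p. 3)] -/
theorem stub_rssViscosityNormalisation : ∀ (ν α : ℝ) (U : EuclideanSpace ℝ (Fin 3) → EuclideanSpace ℝ (Fin 3)) (v : ℝ → EuclideanSpace ℝ (Fin 3) → EuclideanSpace ℝ (Fin 3)), 0 < ν → (∀ t ∈ Set.Iio (0:ℝ), ∀ x, v t x = Literature.Analysis.FluidPDE.pvAnsatz α (fun y _ => U y) t x) → ∀ t ∈ Set.Iio (0:ℝ), ∀ x, ν⁻¹ • v (ν⁻¹ * t) x = Literature.Analysis.FluidPDE.pvAnsatz α (fun y _ => (Real.sqrt ν)⁻¹ • Literature.Analysis.FluidPDE.rotZ (α * Real.log ν) (U (Real.sqrt ν • Literature.Analysis.FluidPDE.rotZ (-(α * Real.log ν)) y))) t x := by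
  intro ν α U v hν hA t ht x
  have ht' : t < 0 := ht
  have hs : ν⁻¹ * t ∈ Set.Iio (0 : ℝ) := mul_neg_of_pos_of_neg (inv_pos.2 hν) ht'
  rw [hA _ hs]
  simp only [pvAnsatz]
  rw [rssVisc_inv_sqrt_neg_inv_mul hν, rssVisc_angle_inv_mul hν α ht', neg_add_rev, rotZ_add,
    rotZ_add]
  simp only [rotZ_smul, smul_smul]
  rw [rssVisc_inv_mul_sqrt_mul]

end Summit.NavierStokesRegularity.NavierStokesRegularity.Theorems.FrequencyRigidity.ScaledEnergySplit
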